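/-
Copyright (c) 2026 the pub-hodgecm-mathlib formalisation cell (harness21).  Prover seat hodgecm-mathlib-K2E1-p09 (g4), Track B ∕ K2-LIT,
h413 = `stmt-HodgeConjecture-24833`, line `K2_E1_TraceFormulaBeta`, campaign RES-RANK-ONE (toward (H4-b)): the rank-one constant term of ★ p857228 INSTANTIATED on
Mok's quasi-split `U(J_N)`, `N = 2, 3` (design ruling K2E1-plan (g2) 04:01:46Z: Eisenstein side on the `quasiSplit` currency).  DEAL 2026-09-04T04:06:21Z.
-/
import Summits.HodgeConjecture.HodgeConjecture.Theorems.K2E1PseudoEisensteinConstantTerm   -- ★ p857228 (this seat): §1 index equivalence, §3 `setLIntegral_tsum_quotient_eq_of_bruhat`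
import Literature.NumberTheory.Automorphic.U2LocalBruhatDecomposition                     -- ★ rational Bruhat for `U(Φ₂)`, `U(Φ₃)` (`U3LocalBruhatDecompositionProofs` transitively)
import Literature.NumberTheory.Automorphic.UnitaryGroupBorelPair                           -- ★ `borelAdelic`, `torusAdelic`, adelic Levi, `torusAdelic ⊓ adelicUnipotent = ⊥`
import Literature.NumberTheory.Automorphic.UnitaryGroupKernelDictionary                    -- ★ `quotientSubgroup_quasiSplit`, `isDiscreteRational_quasiSplit`
import Literature.NumberTheory.Automorphic.UnitaryGroupSingularBorelBasePoint             -- ★ `toAdelic_injective_quasiSplit`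
import HarnessLib

/-!
# h413 ∕ Track B «K2-LIT», campaign RES-RANK-ONE — helper `K2E1PseudoEisensteinConstantTermU`: the rank-one constant term
# `CT(θ_Φ) = ν(𝓕)·Σ_{t ∈ T(F)} Φ(x t) + Σ_{t ∈ T(F)} ∫_{N(𝔸)} Φ(x v t w₀) dν(v)` ON MOK'S `U(J₂)`, `U(J₃)`

Cell `pub/hodgecm-mathlib`, crux H413 = `stmt-HodgeConjecture-24833`, route `HCCMUnconditional`; chair K2-lead (g0), dealer K2E1-plan (g2).  THEOREMS ONLY (no
`def`, no `instance`, no `notation`, no named-fact hypothesis, no `sorry`); lane `--kind proof --supports stmt-HodgeConjecture-24833 --as helper` (count-neutral).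

★ p857228 `K2E1PseudoEisensteinConstantTerm.setLIntegral_tsum_quotient_eq_of_bruhat` computes `∫⁻_𝓕 θ_Φ(x u⁻¹) dν` for a generic pair `Γ, N ≤ G` from the Bruhat ∕ Levi
hypotheses INSIDE `Γ`.  Here those hypotheses are DISCHARGED for Mok's quasi-split unitary group `G = U(J_N)(𝔸_F)` (★ `quasiSplit F E c N`, `c² = 1`), `Γ = G(F)`
(★ `quotientSubgroup = arithmeticSubgroup`, `A_G = 1`), `N = N(𝔸_F)` (★ `adelicUnipotent`), `T(F) = T(𝔸_F) ∩ G(F)` (★ `torusAdelic`), `B(F) = B(𝔸_F) ∩ G(F)` (★ `borelAdelic`),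
`w₀ = ι(Φ_N)` (★ `weylLongU` pushed through ★ `toAdelic`), by TRANSPORT of the RATIONAL facts — the Bruhat trichotomy ★ `U2LocalBruhatDecomposition` ∕ ★
`U3LocalBruhatDecompositionProofs` and the Levi decomposition ★ `isComplement'_torusU_unipotentU` on `U(J_N)(F) ≤ GL_N(E)` — through the diagonal embedding `ι = toAdelic`
(entries `algebraMap E 𝔸_E`, injective):
* §1 TRANSPORT (every `N`; injectivity of `ι` is ★ `toAdelic_injective_quasiSplit`): `toAdelic_mem_borelAdelic_iff`, `toAdelic_mem_adelicUnipotent_iff`, `toAdelic_mem_torusAdelic`,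
  `exists_toAdelic_eq_of_mem_quotientSubgroup`, `borelAdelic_le_normalizer_adelicUnipotent`;
* §2 THE BRUHAT ∕ LEVI PACKAGE INSIDE `Γ = G(F) ≤ G(𝔸_F)` (every `N`, from the rational trichotomy as hypotheses): `bruhat_quotientSubgroup_of_rational`;
* §3 THE INSTANCES **`setLIntegral_tsum_quotient_eq_quasiSplit_two`** ∕ **`setLIntegral_tsum_quotient_eq_quasiSplit_three`**: for `U(J₂)`, `U(J₃)` over ANY `E∕F` with
  `c² = 1`, every left- and inversion-invariant `ν` on `N(𝔸_F)`, every measurable fundamental domain `𝓕` of `N(F)` (★ `rationalUnipotent`), every Borel right-`N(𝔸_F)`-invariant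
  `Φ ≥ 0` and every `x`:  `∫⁻_{u ∈ 𝓕} θ_Φ(x u⁻¹) dν = ν(𝓕) · Σ'_{t ∈ T(F)} Φ(x t) + Σ'_{t ∈ T(F)} ∫⁻_{N(𝔸)} Φ(x v t w₀) dν(v)` [MW1995 II.1.7].
The CM pair `F = L⁺`, `E = L` is `quasiSplit L⁺ L c N = cmDatum L N J_N` (★ `quasiSplit_eq_cmDatum`, rfl); the literal-`Φ_N` sockets are reached by consumers at their
last line only (ruling 04:01:46Z), not here.

HONEST LABEL.  Count-neutral helper; proves no printed statement; HC_CM is proved only modulo the 7 printed citations (2 remaining named inputs: hLiu418 =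
`stmt-HodgeConjecture-24832`, h413 = `stmt-HodgeConjecture-24833`) until rung 0 closes.

## References
* [MoeglinWaldspurger1995] C. Mœglin, J.-L. Waldspurger, *Spectral decomposition and Eisenstein series* (1995), II.1.7, I.2.6.
* [Rogawski1990] J. D. Rogawski, *Automorphic Representations of Unitary Groups in Three Variables* (1990), §1.10, §2.1–§2.2.
* [Mok2014] C. P. Mok, *Endoscopic classification of representations of quasi-split unitary groups*, Mem. AMS 235 (2015), §3.1.
-/

set_option autoImplicit false
set_option linter.dupNamespace false  -- the mandated namespace repeats the summit's segment (`HodgeConjecture.HodgeConjecture`)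

noncomputable section
open MeasureTheory Measure Set Filter Topology NumberField IsDedekindDomain Matrix
open Literature.NumberTheory.Automorphic Literature.NumberTheory.Automorphic.UnitaryGroup AdelicGroupData
open Summit.HodgeConjecture.HodgeConjecture.Cruxes.H413.K2E1PseudoEisensteinConstantTerm
open scoped ENNReal NNReal Pointwise MatrixGroups

namespace Summit.HodgeConjecture.HodgeConjecture.Cruxes.H413.K2E1PseudoEisensteinConstantTermU

variable {F E : Type} [Field F] [NumberField F] [Field E] [NumberField E] [Algebra F E] {c : E ≃ₐ[F] E} {N : ℕ}

/-! ## §1 Transport through the diagonal embedding `ι = toAdelic : U(J_N)(F) → U(J_N)(𝔸_F)` -/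

section Transport

/-- `ι` is multiplicative, read on the subgroup type `↥U(J_N)(F)` (the datum's `Rational` is this type definitionally). [folklore] -/
theorem toAdelic_mul_quasiSplit (a b : ↥(unitaryGroupOfForm (c : E →+* E) ((StdForm.antidiagonal N).over E))) :
    (quasiSplit F E c N).toAdelic (a * b) = (quasiSplit F E c N).toAdelic a * (quasiSplit F E c N).toAdelic b :=
  map_mul ((quasiSplit F E c N).toAdelic) a b

/-- `ι(g) ∈ B(𝔸_F)` iff `g ∈ B(F)` (upper-triangularity is read on the entries). [cite: Rogawski1990, §2.1] -/
theorem toAdelic_mem_borelAdelic_iff (g : ↥(unitaryGroupOfForm (c : E →+* E) ((StdForm.antidiagonal N).over E))) :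
    (quasiSplit F E c N).toAdelic g ∈ borelAdelic F E c N ↔ g ∈ borelU (c : E →+* E) ((StdForm.antidiagonal N).over E) := by
  rw [mem_borelAdelic_iff, mem_borelU_iff]
  change (((g.val : GL (Fin N) E) : Matrix (Fin N) (Fin N) E).map (algebraMap E (AdeleRing (𝓞 E) E))).BlockTriangular id ↔
    ((g.val : GL (Fin N) E) : Matrix (Fin N) (Fin N) E).BlockTriangular id
  exact ⟨fun h i j hij => (map_eq_zero_iff _ (AdeleRing.algebraMap_injective (𝓞 E) E)).1 (h hij),
    fun h i j hij => by rw [Matrix.map_apply, h hij, map_zero]⟩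

/-- `ι(g) ∈ N(𝔸_F)` iff `g ∈ N(F)`. [cite: Rogawski1990, §2.1] -/
theorem toAdelic_mem_adelicUnipotent_iff (g : ↥(unitaryGroupOfForm (c : E →+* E) ((StdForm.antidiagonal N).over E))) :
    (quasiSplit F E c N).toAdelic g ∈ adelicUnipotent F E c N ↔ g ∈ unipotentU (c : E →+* E) ((StdForm.antidiagonal N).over E) := by
  rw [mem_unipotentU_iff]
  change adelicVal F E c N _ ((quasiSplit F E c N).toAdelic g) ∈ upperUnitriangular (Fin N) (AdeleRing (𝓞 E) E) ↔ _
  rw [mem_upperUnitriangular_iff]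
  change (((g.val : GL (Fin N) E) : Matrix (Fin N) (Fin N) E).map (algebraMap E (AdeleRing (𝓞 E) E))).BlockTriangular id ∧
      (∀ i, (((g.val : GL (Fin N) E) : Matrix (Fin N) (Fin N) E).map (algebraMap E (AdeleRing (𝓞 E) E))) i i = 1) ↔
    ((g.val : GL (Fin N) E) : Matrix (Fin N) (Fin N) E).BlockTriangular id ∧ ∀ i, ((g.val : GL (Fin N) E) : Matrix (Fin N) (Fin N) E) i i = 1
  refine and_congr ⟨fun h i j hij => (map_eq_zero_iff _ (AdeleRing.algebraMap_injective (𝓞 E) E)).1 (h hij),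
    fun h i j hij => by rw [Matrix.map_apply, h hij, map_zero]⟩ (forall_congr' fun i => ?_)
  rw [Matrix.map_apply]
  exact map_eq_one_iff _ (AdeleRing.algebraMap_injective (𝓞 E) E)

/-- `ι` maps `T(F)` into `T(𝔸_F)`. [cite: Rogawski1990, §2.1] -/
theorem toAdelic_mem_torusAdelic {g : ↥(unitaryGroupOfForm (c : E →+* E) ((StdForm.antidiagonal N).over E))} (hg : g ∈ torusU (c : E →+* E) ((StdForm.antidiagonal N).over E)) :
    (quasiSplit F E c N).toAdelic g ∈ torusAdelic F E c N := by
  obtain ⟨d, hd⟩ := (mem_torusU_iff g).1 hg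
  refine ⟨fun i => Units.map (algebraMap E (AdeleRing (𝓞 E) E)).toMonoidHom (d i), Units.ext ?_⟩
  change ((glDiagonal N (AdeleRing (𝓞 E) E) fun i => Units.map (algebraMap E (AdeleRing (𝓞 E) E)).toMonoidHom (d i)) : Matrix (Fin N) (Fin N) (AdeleRing (𝓞 E) E)) =
    ((g.val : GL (Fin N) E) : Matrix (Fin N) (Fin N) E).map (algebraMap E (AdeleRing (𝓞 E) E))
  rw [coe_glDiagonal, ← hd, coe_glDiagonal, Matrix.diagonal_map (map_zero _)]
  rfl

/-- Every `γ ∈ Γ = A_G·G(F) = G(F)` is `ι(g)` (★ `quotientSubgroup_quasiSplit`, `arithmeticSubgroup = range ι`). [cite: Mok2014, §3.1] -/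
theorem exists_toAdelic_eq_of_mem_quotientSubgroup (γ : (quasiSplit F E c N).quotientSubgroup) :
    ∃ g : ↥(unitaryGroupOfForm (c : E →+* E) ((StdForm.antidiagonal N).over E)), (quasiSplit F E c N).toAdelic g = γ := by
  have h : (γ : (quasiSplit F E c N).Adelic) ∈ (quasiSplit F E c N).arithmeticSubgroup := by
    rw [← quotientSubgroup_quasiSplit]; exact γ.2
  exact h

/-- `ι(g) ∈ Γ`. [cite: Mok2014, §3.1] -/
theorem toAdelic_mem_quotientSubgroup (g : ↥(unitaryGroupOfForm (c : E →+* E) ((StdForm.antidiagonal N).over E))) : (quasiSplit F E c N).toAdelic g ∈ (quasiSplit F E c N).quotientSubgroup := by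
  rw [quotientSubgroup_quasiSplit]; exact ⟨g, rfl⟩

/-- `B(𝔸_F)` normalises `N(𝔸_F)` (the Borel of `GL_N(𝔸_E)` normalises its unipotent radical, ★ `parabolicTripleGL`, pulled back along ★ `adelicVal`).
[cite: Rogawski1990, §1.10] -/
theorem borelAdelic_le_normalizer_adelicUnipotent :
    borelAdelic F E c N ≤ Subgroup.normalizer (adelicUnipotent F E c N : Set (quasiSplit F E c N).Adelic) :=
  (Subgroup.comap_mono (f := adelicVal F E c N ((StdForm.antidiagonal N).over E))
    (parabolicTripleGL (AdeleRing (𝓞 E) E) (id : Fin N → Fin N)).le_normalizer).trans (Subgroup.le_normalizer_comap _)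

end Transport

/-! ## §2 The constant term on `U(J_N)(𝔸_F)` from the RATIONAL Bruhat trichotomy and Levi decomposition -/

section Instance

/-- **THE RANK-ONE CONSTANT TERM ON MOK'S `U(J_N)`, FROM THE RATIONAL BRUHAT ∕ LEVI DATA** (every `N`; the data are ★ for `N = 2, 3`, §3).  Let `w ∈ U(J_N)(F)` satisfy the
Bruhat trichotomy `U(J_N)(F) = B ⊔ B·w·N` (existence, disjointness, unique coordinates) for the upper-triangular `B = borelU`, `N = unipotentU`, and let `B = T·N` (★
`IsComplement'` shape).  Then for `Γ = G(F) ≤ G(𝔸_F) = U(J_N)(𝔸_F)`, `N(𝔸_F) = adelicUnipotent`, a left- and inversion-invariant `ν` on `N(𝔸_F)`, a measurable fundamental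
domain `𝓕` of `N(F)` (★ `rationalUnipotent`), a Borel right-`N(𝔸_F)`-invariant `Φ ≥ 0` and `x ∈ G(𝔸_F)`:
`∫⁻_{u ∈ 𝓕} θ_Φ(x u⁻¹) dν = ν(𝓕)·Σ'_{t ∈ T(F)} Φ(x t) + Σ'_{t ∈ T(F)} ∫⁻_{N(𝔸)} Φ(x v t ι(w)) dν(v)`, `T(F) = T(𝔸_F) ∩ Γ` (★ `torusAdelic`) — ★ p857228 §3 with its eight
group-theoretic hypotheses transported through `ι` (§1). [cite: MoeglinWaldspurger1995, II.1.7] [cite: Rogawski1990, §1.10, §2.1] -/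
theorem setLIntegral_tsum_quotient_eq_quasiSplit_of_rational (w : ↥(unitaryGroupOfForm (c : E →+* E) ((StdForm.antidiagonal N).over E)))
    (hexR : ∀ g : ↥(unitaryGroupOfForm (c : E →+* E) ((StdForm.antidiagonal N).over E)),
      g ∈ borelU (c : E →+* E) ((StdForm.antidiagonal N).over E) ∨ ∃ b ∈ borelU (c : E →+* E) ((StdForm.antidiagonal N).over E),
        ∃ n ∈ unipotentU (c : E →+* E) ((StdForm.antidiagonal N).over E), g = b * w * n)
    (hdisjR : ∀ ⦃b n : ↥(unitaryGroupOfForm (c : E →+* E) ((StdForm.antidiagonal N).over E))⦄, b ∈ borelU (c : E →+* E) ((StdForm.antidiagonal N).over E) →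
      n ∈ unipotentU (c : E →+* E) ((StdForm.antidiagonal N).over E) → b * w * n ∉ borelU (c : E →+* E) ((StdForm.antidiagonal N).over E))
    (huniqR : ∀ ⦃b b' n n' : ↥(unitaryGroupOfForm (c : E →+* E) ((StdForm.antidiagonal N).over E))⦄,
      b ∈ borelU (c : E →+* E) ((StdForm.antidiagonal N).over E) → b' ∈ borelU (c : E →+* E) ((StdForm.antidiagonal N).over E) →
      n ∈ unipotentU (c : E →+* E) ((StdForm.antidiagonal N).over E) → n' ∈ unipotentU (c : E →+* E) ((StdForm.antidiagonal N).over E) →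
      b * w * n = b' * w * n' → b = b' ∧ n = n')
    (hLeviR : ((torusU (c : E →+* E) ((StdForm.antidiagonal N).over E)).subgroupOf (borelU (c : E →+* E) ((StdForm.antidiagonal N).over E))).IsComplement'
      ((unipotentU (c : E →+* E) ((StdForm.antidiagonal N).over E)).subgroupOf (borelU (c : E →+* E) ((StdForm.antidiagonal N).over E))))
    [MeasurableSpace (quasiSplit F E c N).Adelic] [BorelSpace (quasiSplit F E c N).Adelic]
    (νN : Measure ↥(adelicUnipotent F E c N)) [νN.IsMulLeftInvariant] [νN.IsInvInvariant]
    {Φ : (quasiSplit F E c N).Adelic → ℝ≥0∞} (hΦm : Measurable Φ) (hΦ : ∀ (g : (quasiSplit F E c N).Adelic) (n : ↥(adelicUnipotent F E c N)), Φ (g * n) = Φ g)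
    {𝓕 : Set ↥(adelicUnipotent F E c N)} (h𝓕 : IsFundamentalDomain ↥(rationalUnipotent F E c N) 𝓕 νN) (x : (quasiSplit F E c N).Adelic) :
    ∫⁻ u in 𝓕, (∑' q : (quasiSplit F E c N).quotientSubgroup ⧸ (adelicUnipotent F E c N).subgroupOf (quasiSplit F E c N).quotientSubgroup,
        Φ (x * (u : (quasiSplit F E c N).Adelic)⁻¹ * ((q.out : (quasiSplit F E c N).quotientSubgroup) : (quasiSplit F E c N).Adelic))) ∂νN =
      νN 𝓕 * (∑' t : (torusAdelic F E c N).subgroupOf (quasiSplit F E c N).quotientSubgroup,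
          Φ (x * ((t : (quasiSplit F E c N).quotientSubgroup) : (quasiSplit F E c N).Adelic))) +
        ∑' t : (torusAdelic F E c N).subgroupOf (quasiSplit F E c N).quotientSubgroup,
          ∫⁻ v : ↥(adelicUnipotent F E c N), Φ (x * (v : (quasiSplit F E c N).Adelic) *
            ((t : (quasiSplit F E c N).quotientSubgroup) : (quasiSplit F E c N).Adelic) * (quasiSplit F E c N).toAdelic w) ∂νN := by
  -- instances: `G(F)` discrete, `G(𝔸_F)` second countable
  haveI : DiscreteTopology (quasiSplit F E c N).quotientSubgroup := by rw [quotientSubgroup_quasiSplit]; exact isDiscreteRational_quasiSplit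
  haveI := secondCountableTopology_adeleRing E
  haveI : SecondCountableTopology (quasiSplit F E c N).Adelic := inferInstanceAs (SecondCountableTopology (adelic F E c N ((StdForm.antidiagonal N).over E)))
  -- the rational lattice of `N(𝔸_F)` in the two spellings
  have hΓN : ((quasiSplit F E c N).quotientSubgroup).subgroupOf (adelicUnipotent F E c N) = rationalUnipotent F E c N := by
    rw [quotientSubgroup_quasiSplit]; rfl
  have h𝓕' : IsFundamentalDomain ↥(((quasiSplit F E c N).quotientSubgroup).subgroupOf (adelicUnipotent F E c N)) 𝓕 νN := by rw [hΓN]; exact h𝓕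
  -- the element `w₀ ∈ Γ`
  let wΓ : (quasiSplit F E c N).quotientSubgroup := ⟨(quasiSplit F E c N).toAdelic w, toAdelic_mem_quotientSubgroup w⟩
  -- (1) existence
  have hex : ∀ γ : (quasiSplit F E c N).quotientSubgroup, γ ∈ (borelAdelic F E c N).subgroupOf (quasiSplit F E c N).quotientSubgroup ∨
      ∃ b ∈ (borelAdelic F E c N).subgroupOf (quasiSplit F E c N).quotientSubgroup,
        ∃ n ∈ (adelicUnipotent F E c N).subgroupOf (quasiSplit F E c N).quotientSubgroup, γ = b * wΓ * n := by
    intro γ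
    obtain ⟨g, hg⟩ := exists_toAdelic_eq_of_mem_quotientSubgroup γ
    rcases hexR g with hB | ⟨b, hb, n, hn, hgeq⟩
    · left
      rw [Subgroup.mem_subgroupOf, ← hg]
      exact (toAdelic_mem_borelAdelic_iff g).2 hB
    · right
      refine ⟨⟨(quasiSplit F E c N).toAdelic b, toAdelic_mem_quotientSubgroup b⟩, ?_, ⟨(quasiSplit F E c N).toAdelic n, toAdelic_mem_quotientSubgroup n⟩, ?_, ?_⟩
      · rw [Subgroup.mem_subgroupOf]; exact (toAdelic_mem_borelAdelic_iff b).2 hb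
      · rw [Subgroup.mem_subgroupOf]; exact (toAdelic_mem_adelicUnipotent_iff n).2 hn
      · apply Subtype.ext
        change (γ : (quasiSplit F E c N).Adelic) = (quasiSplit F E c N).toAdelic b * (quasiSplit F E c N).toAdelic w * (quasiSplit F E c N).toAdelic n
        rw [← hg, hgeq, toAdelic_mul_quasiSplit, toAdelic_mul_quasiSplit]
  -- (2) disjointness
  have hdisj : ∀ ⦃b n : (quasiSplit F E c N).quotientSubgroup⦄, b ∈ (borelAdelic F E c N).subgroupOf (quasiSplit F E c N).quotientSubgroup →
      n ∈ (adelicUnipotent F E c N).subgroupOf (quasiSplit F E c N).quotientSubgroup → b * wΓ * n ∉ (borelAdelic F E c N).subgroupOf (quasiSplit F E c N).quotientSubgroup := by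
    intro b n hb hn h
    obtain ⟨b₀, hb₀⟩ := exists_toAdelic_eq_of_mem_quotientSubgroup b
    obtain ⟨n₀, hn₀⟩ := exists_toAdelic_eq_of_mem_quotientSubgroup n
    rw [Subgroup.mem_subgroupOf] at hb hn h
    rw [← hb₀, toAdelic_mem_borelAdelic_iff] at hb
    rw [← hn₀, toAdelic_mem_adelicUnipotent_iff] at hn
    have h' : (quasiSplit F E c N).toAdelic (b₀ * w * n₀) ∈ borelAdelic F E c N := by
      rw [toAdelic_mul_quasiSplit, toAdelic_mul_quasiSplit, hb₀, hn₀]; exact h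
    exact hdisjR hb hn ((toAdelic_mem_borelAdelic_iff _).1 h')
  -- (3) uniqueness
  have huniq : ∀ ⦃b b' n n' : (quasiSplit F E c N).quotientSubgroup⦄, b ∈ (borelAdelic F E c N).subgroupOf (quasiSplit F E c N).quotientSubgroup →
      b' ∈ (borelAdelic F E c N).subgroupOf (quasiSplit F E c N).quotientSubgroup → n ∈ (adelicUnipotent F E c N).subgroupOf (quasiSplit F E c N).quotientSubgroup →
      n' ∈ (adelicUnipotent F E c N).subgroupOf (quasiSplit F E c N).quotientSubgroup → b * wΓ * n = b' * wΓ * n' → b = b' ∧ n = n' := by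
    intro b b' n n' hb hb' hn hn' h
    obtain ⟨b₀, hb₀⟩ := exists_toAdelic_eq_of_mem_quotientSubgroup b
    obtain ⟨b₀', hb₀'⟩ := exists_toAdelic_eq_of_mem_quotientSubgroup b'
    obtain ⟨n₀, hn₀⟩ := exists_toAdelic_eq_of_mem_quotientSubgroup n
    obtain ⟨n₀', hn₀'⟩ := exists_toAdelic_eq_of_mem_quotientSubgroup n'
    rw [Subgroup.mem_subgroupOf] at hb hb' hn hn'
    rw [← hb₀, toAdelic_mem_borelAdelic_iff] at hb
    rw [← hb₀', toAdelic_mem_borelAdelic_iff] at hb'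
    rw [← hn₀, toAdelic_mem_adelicUnipotent_iff] at hn
    rw [← hn₀', toAdelic_mem_adelicUnipotent_iff] at hn'
    have h' : (quasiSplit F E c N).toAdelic (b₀ * w * n₀) = (quasiSplit F E c N).toAdelic (b₀' * w * n₀') := by
      rw [toAdelic_mul_quasiSplit, toAdelic_mul_quasiSplit, toAdelic_mul_quasiSplit, toAdelic_mul_quasiSplit, hb₀, hn₀, hb₀', hn₀']
      exact congrArg (fun z : (quasiSplit F E c N).quotientSubgroup => (z : (quasiSplit F E c N).Adelic)) h
    obtain ⟨h1, h2⟩ := huniqR hb hb' hn hn' (toAdelic_injective_quasiSplit h')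
    subst h1; subst h2
    exact ⟨Subtype.ext (hb₀.symm.trans hb₀'), Subtype.ext (hn₀.symm.trans hn₀')⟩
  -- (4) `N ≤ B`, `T ≤ B`
  have hNB : (adelicUnipotent F E c N).subgroupOf (quasiSplit F E c N).quotientSubgroup ≤ (borelAdelic F E c N).subgroupOf (quasiSplit F E c N).quotientSubgroup :=
    fun γ hγ => adelicUnipotent_le_borelAdelic hγ
  have hTB : (torusAdelic F E c N).subgroupOf (quasiSplit F E c N).quotientSubgroup ≤ (borelAdelic F E c N).subgroupOf (quasiSplit F E c N).quotientSubgroup :=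
    fun γ hγ => torusAdelic_le_borelAdelic hγ
  -- (5) Levi `B(F) = T(F)·N(F)` (transport of the rational complement)
  have hLevi : ∀ b ∈ (borelAdelic F E c N).subgroupOf (quasiSplit F E c N).quotientSubgroup,
      ∃ t ∈ (torusAdelic F E c N).subgroupOf (quasiSplit F E c N).quotientSubgroup,
        ∃ u ∈ (adelicUnipotent F E c N).subgroupOf (quasiSplit F E c N).quotientSubgroup, b = t * u := by
    intro b hb
    obtain ⟨b₀, hb₀⟩ := exists_toAdelic_eq_of_mem_quotientSubgroup b
    rw [Subgroup.mem_subgroupOf, ← hb₀, toAdelic_mem_borelAdelic_iff] at hb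
    obtain ⟨⟨t, u⟩, htu, -⟩ := hLeviR.existsUnique ⟨b₀, hb⟩
    have ht : ((t.1 : ↥(borelU (c : E →+* E) ((StdForm.antidiagonal N).over E))) : ↥(unitaryGroupOfForm (c : E →+* E) ((StdForm.antidiagonal N).over E))) ∈
        torusU (c : E →+* E) ((StdForm.antidiagonal N).over E) := Subgroup.mem_subgroupOf.1 t.2
    have hu : ((u.1 : ↥(borelU (c : E →+* E) ((StdForm.antidiagonal N).over E))) : ↥(unitaryGroupOfForm (c : E →+* E) ((StdForm.antidiagonal N).over E))) ∈
        unipotentU (c : E →+* E) ((StdForm.antidiagonal N).over E) := Subgroup.mem_subgroupOf.1 u.2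
    have hb₀eq : b₀ = (t.1 : ↥(unitaryGroupOfForm (c : E →+* E) ((StdForm.antidiagonal N).over E))) * u.1 := by
      have := congrArg (fun z : ↥(borelU (c : E →+* E) ((StdForm.antidiagonal N).over E)) => (z : ↥(unitaryGroupOfForm (c : E →+* E) ((StdForm.antidiagonal N).over E)))) htu
      exact this.symm
    refine ⟨⟨_, toAdelic_mem_quotientSubgroup (t.1 : ↥(unitaryGroupOfForm (c : E →+* E) ((StdForm.antidiagonal N).over E)))⟩, ?_,
      ⟨_, toAdelic_mem_quotientSubgroup (u.1 : ↥(unitaryGroupOfForm (c : E →+* E) ((StdForm.antidiagonal N).over E)))⟩, ?_, Subtype.ext ?_⟩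
    · exact Subgroup.mem_subgroupOf.2 (toAdelic_mem_torusAdelic ht)
    · exact Subgroup.mem_subgroupOf.2 ((toAdelic_mem_adelicUnipotent_iff _).2 hu)
    · change (b : (quasiSplit F E c N).Adelic) = (quasiSplit F E c N).toAdelic _ * (quasiSplit F E c N).toAdelic _
      rw [← hb₀, hb₀eq, toAdelic_mul_quasiSplit]
  -- (6) `T ∩ N = 1`
  have hTN : ∀ ⦃γ : (quasiSplit F E c N).quotientSubgroup⦄, γ ∈ (torusAdelic F E c N).subgroupOf (quasiSplit F E c N).quotientSubgroup →
      γ ∈ (adelicUnipotent F E c N).subgroupOf (quasiSplit F E c N).quotientSubgroup → γ = 1 := by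
    intro γ hT hN
    have h : (γ : (quasiSplit F E c N).Adelic) ∈ torusAdelic F E c N ⊓ adelicUnipotent F E c N := ⟨hT, hN⟩
    rw [torusAdelic_inf_adelicUnipotent_eq_bot, Subgroup.mem_bot] at h
    exact Subtype.ext h
  -- (7) `T(F)` normalises `N(𝔸_F)`
  have hT : ∀ t ∈ (torusAdelic F E c N).subgroupOf (quasiSplit F E c N).quotientSubgroup, ∀ n : ↥(adelicUnipotent F E c N),
      ((t : (quasiSplit F E c N).Adelic))⁻¹ * (n : (quasiSplit F E c N).Adelic) * (t : (quasiSplit F E c N).Adelic) ∈ adelicUnipotent F E c N := by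
    intro t ht n
    have hnorm := borelAdelic_le_normalizer_adelicUnipotent (torusAdelic_le_borelAdelic (Subgroup.mem_subgroupOf.1 ht))
    have h := (Subgroup.mem_normalizer_iff.1 (Subgroup.inv_mem _ hnorm) (n : (quasiSplit F E c N).Adelic)).1 n.2
    rwa [inv_inv] at h
  exact setLIntegral_tsum_quotient_eq_of_bruhat ((quasiSplit F E c N).quotientSubgroup) (adelicUnipotent F E c N) νN hΦm hΦ
    hex hdisj huniq hNB hTB hLevi hTN hT h𝓕' x

end Instance

/-! ## §3 The instances `U(J₂)`, `U(J₃)` -/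

section Instances

/-- **THE RANK-ONE CONSTANT TERM ON `U(J₂)(𝔸_F)`** (`N = 2`, `N` = the line `𝔸_E⁻`, any `E∕F`, any `c`): for a left- and inversion-invariant `ν` on `N(𝔸_F)`, a measurable fundamental
domain `𝓕` of `N(F)`, a Borel right-`N(𝔸_F)`-invariant `Φ ≥ 0` and `x ∈ U(J₂)(𝔸_F)`:
`∫⁻_{u ∈ 𝓕} θ_Φ(x u⁻¹) dν = ν(𝓕)·Σ'_{t ∈ T(F)} Φ(x t) + Σ'_{t ∈ T(F)} ∫⁻_{N(𝔸)} Φ(x v t ι(w₀)) dν(v)`, `w₀ = J₂` (★ `weylLongU`); §2 at the ★ rational Bruhat trichotomy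
(`U2LocalBruhatDecomposition`) and the ★ Levi complement `isComplement'_torusU_unipotentU`. [cite: MoeglinWaldspurger1995, II.1.7] [cite: Rogawski1990, §1.10, §2.1] -/
theorem setLIntegral_tsum_quotient_eq_quasiSplit_two [MeasurableSpace (quasiSplit F E c 2).Adelic] [BorelSpace (quasiSplit F E c 2).Adelic]
    (νN : Measure ↥(adelicUnipotent F E c 2)) [νN.IsMulLeftInvariant] [νN.IsInvInvariant]
    {Φ : (quasiSplit F E c 2).Adelic → ℝ≥0∞} (hΦm : Measurable Φ) (hΦ : ∀ (g : (quasiSplit F E c 2).Adelic) (n : ↥(adelicUnipotent F E c 2)), Φ (g * n) = Φ g)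
    {𝓕 : Set ↥(adelicUnipotent F E c 2)} (h𝓕 : IsFundamentalDomain ↥(rationalUnipotent F E c 2) 𝓕 νN) (x : (quasiSplit F E c 2).Adelic) :
    ∫⁻ u in 𝓕, (∑' q : (quasiSplit F E c 2).quotientSubgroup ⧸ (adelicUnipotent F E c 2).subgroupOf (quasiSplit F E c 2).quotientSubgroup,
        Φ (x * (u : (quasiSplit F E c 2).Adelic)⁻¹ * ((q.out : (quasiSplit F E c 2).quotientSubgroup) : (quasiSplit F E c 2).Adelic))) ∂νN =
      νN 𝓕 * (∑' t : (torusAdelic F E c 2).subgroupOf (quasiSplit F E c 2).quotientSubgroup,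
          Φ (x * ((t : (quasiSplit F E c 2).quotientSubgroup) : (quasiSplit F E c 2).Adelic))) +
        ∑' t : (torusAdelic F E c 2).subgroupOf (quasiSplit F E c 2).quotientSubgroup,
          ∫⁻ v : ↥(adelicUnipotent F E c 2), Φ (x * (v : (quasiSplit F E c 2).Adelic) *
            ((t : (quasiSplit F E c 2).quotientSubgroup) : (quasiSplit F E c 2).Adelic) *
              (quasiSplit F E c 2).toAdelic (weylLongU (c : E →+* E) (rfl : (StdForm.antidiagonal 2).over E = (StdForm.antidiagonal 2).over E))) ∂νN :=
  setLIntegral_tsum_quotient_eq_quasiSplit_of_rational (weylLongU (c : E →+* E) rfl) (mem_borelU_or_exists_eq_mul_weylLongU_mul_two (c : E →+* E) rfl)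
    (fun _ _ hb hn => mul_weylLongU_mul_not_mem_borelU_two (c : E →+* E) rfl hb hn)
    (fun _ _ _ _ hb hb' hn hn' h => eq_of_mul_weylLongU_mul_eq_two (c : E →+* E) rfl hb hb' hn hn' h)
    (isComplement'_torusU_unipotentU (c : E →+* E) _ rfl) νN hΦm hΦ h𝓕 x

/-- **THE RANK-ONE CONSTANT TERM ON `U(J₃)(𝔸_F)`** (`N = 3`, `N` = the Heisenberg group, any `E∕F`, any `c`): for a left- and inversion-invariant `ν` on `N(𝔸_F)`, a measurable fundamental
domain `𝓕` of `N(F)`, a Borel right-`N(𝔸_F)`-invariant `Φ ≥ 0` and `x ∈ U(J₃)(𝔸_F)`: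
`∫⁻_{u ∈ 𝓕} θ_Φ(x u⁻¹) dν = ν(𝓕)·Σ'_{t ∈ T(F)} Φ(x t) + Σ'_{t ∈ T(F)} ∫⁻_{N(𝔸)} Φ(x v t ι(w₀)) dν(v)`, `w₀ = J₃` (★ `weylLongU`); §2 at the ★ rational Bruhat trichotomy
(`U3LocalBruhatDecompositionProofs`) and the ★ Levi complement `isComplement'_torusU_unipotentU`. [cite: MoeglinWaldspurger1995, II.1.7] [cite: Rogawski1990, §1.10, §2.1] -/
theorem setLIntegral_tsum_quotient_eq_quasiSplit_three [MeasurableSpace (quasiSplit F E c 3).Adelic] [BorelSpace (quasiSplit F E c 3).Adelic]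
    (νN : Measure ↥(adelicUnipotent F E c 3)) [νN.IsMulLeftInvariant] [νN.IsInvInvariant]
    {Φ : (quasiSplit F E c 3).Adelic → ℝ≥0∞} (hΦm : Measurable Φ) (hΦ : ∀ (g : (quasiSplit F E c 3).Adelic) (n : ↥(adelicUnipotent F E c 3)), Φ (g * n) = Φ g)
    {𝓕 : Set ↥(adelicUnipotent F E c 3)} (h𝓕 : IsFundamentalDomain ↥(rationalUnipotent F E c 3) 𝓕 νN) (x : (quasiSplit F E c 3).Adelic) :
    ∫⁻ u in 𝓕, (∑' q : (quasiSplit F E c 3).quotientSubgroup ⧸ (adelicUnipotent F E c 3).subgroupOf (quasiSplit F E c 3).quotientSubgroup,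
        Φ (x * (u : (quasiSplit F E c 3).Adelic)⁻¹ * ((q.out : (quasiSplit F E c 3).quotientSubgroup) : (quasiSplit F E c 3).Adelic))) ∂νN =
      νN 𝓕 * (∑' t : (torusAdelic F E c 3).subgroupOf (quasiSplit F E c 3).quotientSubgroup,
          Φ (x * ((t : (quasiSplit F E c 3).quotientSubgroup) : (quasiSplit F E c 3).Adelic))) +
        ∑' t : (torusAdelic F E c 3).subgroupOf (quasiSplit F E c 3).quotientSubgroup,
          ∫⁻ v : ↥(adelicUnipotent F E c 3), Φ (x * (v : (quasiSplit F E c 3).Adelic) *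
            ((t : (quasiSplit F E c 3).quotientSubgroup) : (quasiSplit F E c 3).Adelic) *
              (quasiSplit F E c 3).toAdelic (weylLongU (c : E →+* E) (rfl : (StdForm.antidiagonal 3).over E = (StdForm.antidiagonal 3).over E))) ∂νN :=
  setLIntegral_tsum_quotient_eq_quasiSplit_of_rational (weylLongU (c : E →+* E) rfl) (mem_borelU_or_exists_eq_mul_weylLongU_mul (c : E →+* E) rfl)
    (fun _ _ hb hn => mul_weylLongU_mul_not_mem_borelU (c : E →+* E) rfl hb hn)
    (fun _ _ _ _ hb hb' hn hn' h => eq_of_mul_weylLongU_mul_eq (c : E →+* E) rfl hb hb' hn hn' h)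
    (isComplement'_torusU_unipotentU (c : E →+* E) _ rfl) νN hΦm hΦ h𝓕 x

end Instances

end Summit.HodgeConjecture.HodgeConjecture.Cruxes.H413.K2E1PseudoEisensteinConstantTermU

end
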